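import Literature.Analysis.Calculus.UnitsSmoothFlow                    -- ★ B3 (p833776): `derivAlong`, the flow identity `iteratedDeriv_comp_mul_exp_smul`, uniform bounds
import Literature.Analysis.Convolution.DixmierMalliavinKernelScaled        -- ★ B1: `exists_kernel_package_tsupport_subset`, `eq_integral_sub_integral_of_bounded_iteratedDeriv`
import Mathlib.Analysis.Calculus.SmoothSeries
import Mathlib.MeasureTheory.Integral.Pi
import Mathlib.MeasureTheory.Integral.Prod
import HarnessLib

/-!
# Dixmier–Malliavin on a real Banach algebra, I: the one-parameter step and its iteration over a list of directions
# (Dixmier–Malliavin 1978, §3 Thm. 3.1, steps (i)–(ii) of the Lie-group case)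

Topic `Analysis/Convolution`; namespace `Literature.Analysis.Convolution.DixmierMalliavin`.  THEOREMS ONLY (no definition, no instance, no notation,
no named fact, no `sorry`).  Brick B4 of the road «DM∞» (F0∕P3, `F0/P3/p03/CENSUS-DMinf.F0P3p03g8.md`; consumer: the archimedean residual `stub_DMarch` of
letter #100 «SSG», i.e. ★ `UnitaryGroup.ArchTestConvSpan`).

SETTING.  `A` a real Banach algebra (`[NormedRing A] [NormedAlgebra ℝ A] [CompleteSpace A]`; downstream `A = M_N(L ⊗ ℝ)`), `exp = NormedSpace.exp`, the
right-multiplication flows `s ↦ M · exp (s X)` and the derivative `derivAlong X Θ M = DΘ(M)[M·X]` along them (★ B3).  The class `𝒞` of the road is spelled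
INLINE: `ContDiff ℝ ∞ Θ ∧ HasCompactSupport Θ ∧ tsupport Θ ⊆ {M | IsUnit M}`.

* §1 **ONE STEP** `exists_step` [DixmierMalliavin1978, §3, proof of Thm. 3.1, first display]: for `Θ ∈ 𝒞`, `X ∈ A`, `δ > 0` there are `f, h ∈ C_c^∞(ℝ)` supported in
  `[−δ, δ]` and `Θ₁ ∈ 𝒞` (indeed `Θ₁ = Σ_j (−1)ʲ b_j (derivAlong X)^{2j} Θ`, `tsupport Θ₁ ⊆ tsupport Θ`) with
  **`Θ M = ∫ f(s) Θ₁(M · exp(−sX)) ds − ∫ h(s) Θ(M · exp(−sX)) ds`** for EVERY `M ∈ A` — the 1-D kernel package (★ B1 `exists_kernel_package_tsupport_subset`,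
  growth `M_j = 2ʲ(1 + Σ_{k≤j} sup‖Dᵏ (derivAlong X)^{2j} Θ‖)` from ★ B3's bounds) applied to the slices `u_M(s) = Θ(M · exp(sX))` (★ B1
  `eq_integral_sub_integral_of_bounded_iteratedDeriv`; `u_M^{(m)}(s) = ((derivAlong X)^m Θ)(M · exp(sX))`, ★ B3 `iteratedDeriv_comp_mul_exp_smul`), and
  `Θ₁` smooth by `contDiff_tsum_of_eventually` (`b_j sup‖Dᵏ(derivAlong X)^{2j}Θ‖ ≤ 2^{−j}` for `j ≥ max k 1`).
* §2 **ITERATION** `exists_sum_integral_pi` [loc. cit., «en itérant»]: for directions `X : Fin d → A`, `Θ ∈ 𝒞` and `δ > 0` there are finitely many (`ι`, `Fintype`)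
  kernels `κ_i : Fin d → C_c^∞(ℝ)` supported in `[−δ, δ]` and `Θ_i ∈ 𝒞` with
  **`Θ M = Σ_i ∫_{s : Fin d → ℝ} (∏_j κ_i j (s j)) · Θ_i (M · ∏_{j<d} exp(s_j X_j)) ds`** (`(List.ofFn fun j => exp (s j • X j)).prod`), by induction on `d`:
  one step along `X 0` in the reflected form `Θ M = Σ_{a ∈ Fin 2} ∫ φ_a(t) Ξ_a(M · exp(tX₀)) dt`, the induction hypothesis for `X ∘ Fin.succ` on each `Ξ_a`, and
  Fubini on `ℝ × (Fin d → ℝ) ≃ (Fin (d+1) → ℝ)` (Mathlib `measurePreserving_piFinSuccAbove`, `integral_prod`; the integrands are continuous with compact support).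
What B6∕B7 do with it: for `δ` small the map `s ↦ ∏ exp(s_j X_j)` is a chart of the unitary group near `1` and `∫ k(s) F(∏ exp(s_j X_j)) ds = ∫ a F dμ_Haar` with
`a ∈ C_c` (★ B5∕B6), so each term is a convolution `Θ_i ⋆ a_i^∨` on the group — the WEAK Dixmier–Malliavin factorisation.
HONEST LABEL: HC_CM is proved only modulo the printed citations until rung 0 closes; this file is generic real analysis and introduces no debt.

## References
* J. Dixmier, P. Malliavin, *Factorisations de fonctions et de vecteurs indéfiniment différentiables*, Bull. Sci. Math. (2) 102 (1978) 305–330, §2 Lemmes 2.5–2.8,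
  §3 Thm. 3.1 [DixmierMalliavin1978].
* D. Hegde, *Schwartz functions, Hadamard products, and the Dixmier–Malliavin theorem*, arXiv:2103.05495 (2021), §3.3 [Hegde2021].
* A. W. Knapp, *Lie Groups Beyond an Introduction*, 2nd ed. (2002), Chap. I §10 [Knapp2002].
-/

set_option autoImplicit false

noncomputable section

open MeasureTheory Filter Set Function NormedSpace
open Literature.Analysis.Calculus
open scoped Topology ContDiff

namespace Literature.Analysis.Convolution.DixmierMalliavin

/-! ## §1 One step along a direction `X` -/

section Step

variable {A : Type*} [NormedRing A] [NormedAlgebra ℝ A] [CompleteSpace A]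

/-- **ONE STEP OF DIXMIER–MALLIAVIN ALONG `X`** [DixmierMalliavin1978, §3 Thm. 3.1, first display of the proof]: for `Θ : A → ℂ` smooth with compact support
inside the units, `X ∈ A` and `δ > 0`, there are `f, h ∈ C_c^∞(ℝ)` supported in `[−δ, δ]` and `Θ₁ = Σ_j (−1)ʲ b_j (derivAlong X)^{2j} Θ` — smooth, with
`tsupport Θ₁ ⊆ tsupport Θ` — such that `Θ(M) = ∫ f(s) Θ₁(M · e^{−sX}) ds − ∫ h(s) Θ(M · e^{−sX}) ds` for every `M`: the `ℝ`-kernel package (★ B1) on the slices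
`s ↦ Θ(M · e^{sX})`, whose derivatives are the `(derivAlong X)^m Θ` along the flow (★ B3) and are bounded uniformly in `M` (compact support).
[cite: DixmierMalliavin1978, §3 Thm. 3.1] [cite: Hegde2021, §3.3] -/
theorem exists_step (Θ : A → ℂ) (hΘ : ContDiff ℝ ∞ Θ) (hc : HasCompactSupport Θ) (hU : tsupport Θ ⊆ {M | IsUnit M}) (X : A)
    {δ : ℝ} (hδ : 0 < δ) :
    ∃ (f h : ℝ → ℂ) (Θ₁ : A → ℂ), ContDiff ℝ ∞ f ∧ HasCompactSupport f ∧ tsupport f ⊆ Set.Icc (-δ) δ ∧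
      ContDiff ℝ ∞ h ∧ HasCompactSupport h ∧ tsupport h ⊆ Set.Icc (-δ) δ ∧
      ContDiff ℝ ∞ Θ₁ ∧ HasCompactSupport Θ₁ ∧ tsupport Θ₁ ⊆ tsupport Θ ∧ tsupport Θ₁ ⊆ {M | IsUnit M} ∧
      ∀ M, Θ M = (∫ s, f s * Θ₁ (M * exp ((-s) • X))) - ∫ s, h s * Θ (M * exp ((-s) • X)) := by
  classical
  -- uniform bounds `‖Dᵏ ((derivAlong X)^[n] Θ)‖ ≤ C k n`
  have hCex := fun k n => exists_forall_norm_iteratedFDeriv_iterate_derivAlong_le X hΘ hc k n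
  choose C hC0 hC using hCex
  -- the growth sequence `M j = 2^j (1 + Σ_{k ≤ j} C k (2j))` and the kernel package for it
  obtain ⟨Mg, hMg⟩ : ∃ Mg : ℕ → ℝ, Mg = fun j => 2 ^ j * (1 + ∑ k ∈ Finset.range (j + 1), C k (2 * j)) := ⟨_, rfl⟩
  have hT0 : ∀ j, 0 ≤ ∑ k ∈ Finset.range (j + 1), C k (2 * j) := fun j => Finset.sum_nonneg fun k _ => hC0 k _
  obtain ⟨b, f, h, hb0, hbM, hf, hfc, hfs, hh, hhc, hhs, hlim⟩ := exists_kernel_package_tsupport_subset hδ Mg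
  -- the decay `b_j C k (2j) ≤ 2^{-j}` for `k ≤ j`, `1 ≤ j`
  have hdecay : ∀ k j, k ≤ j → 1 ≤ j → b j * C k (2 * j) ≤ ((1 : ℝ) / 2) ^ j := by
    intro k j hkj hj
    have h1 : C k (2 * j) ≤ ∑ k ∈ Finset.range (j + 1), C k (2 * j) :=
      Finset.single_le_sum (fun k _ => hC0 k (2 * j)) (Finset.mem_range.2 (Nat.lt_succ_of_le hkj))
    have h2 : b j * C k (2 * j) ≤ b j * (1 + ∑ k ∈ Finset.range (j + 1), C k (2 * j)) :=
      mul_le_mul_of_nonneg_left (by linarith) (hb0 j)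
    have h3 : b j * (1 + ∑ k ∈ Finset.range (j + 1), C k (2 * j)) * 2 ^ j ≤ 1 := by
      have := hbM j hj
      rw [hMg] at this
      calc b j * (1 + ∑ k ∈ Finset.range (j + 1), C k (2 * j)) * 2 ^ j = b j * (2 ^ j * (1 + ∑ k ∈ Finset.range (j + 1), C k (2 * j))) := by ring
        _ ≤ 1 := this
    have h4 : b j * (1 + ∑ k ∈ Finset.range (j + 1), C k (2 * j)) ≤ ((1 : ℝ) / 2) ^ j := by
      rw [div_pow, one_pow, le_div_iff₀ (by positivity)]
      exact h3
    exact h2.trans h4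
  -- the terms `g j = (−1)ʲ b_j (derivAlong X)^[2j] Θ` and their sum `Θ₁`
  obtain ⟨g, hg⟩ : ∃ g : ℕ → A → ℂ, g = fun j M => (-1 : ℂ) ^ j * b j * ((derivAlong X)^[2 * j] Θ) M := ⟨_, rfl⟩
  have hgs : ∀ j, ContDiff ℝ ∞ (g j) := fun j => by
    rw [hg]
    exact contDiff_const.mul (contDiff_iterate_derivAlong X hΘ _)
  have hgbound : ∀ (k j : ℕ) (M : A), ‖iteratedFDeriv ℝ k (g j) M‖ ≤ b j * C k (2 * j) := by
    intro k j M
    have e : g j = ((-1 : ℂ) ^ j * b j) • ((derivAlong X)^[2 * j] Θ) := by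
      rw [hg]; funext M; simp only [Pi.smul_apply, smul_eq_mul]
    rw [e, iteratedFDeriv_const_smul_apply ((contDiff_iterate_derivAlong X hΘ _).contDiffAt.of_le (mod_cast le_top)), norm_smul]
    have hn : ‖((-1 : ℂ) ^ j * b j)‖ = b j := by
      rw [norm_mul, norm_pow, norm_neg, norm_one, one_pow, one_mul, Complex.norm_real, Real.norm_eq_abs, abs_of_nonneg (hb0 j)]
    rw [hn]
    exact mul_le_mul_of_nonneg_left (hC k (2 * j) M) (hb0 j)
  obtain ⟨Θ₁, hΘ₁⟩ : ∃ Θ₁ : A → ℂ, Θ₁ = fun M => ∑' j, g j M := ⟨_, rfl⟩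
  have hΘ₁s : ContDiff ℝ ∞ Θ₁ := by
    rw [hΘ₁]
    refine contDiff_tsum_of_eventually (fun j => hgs j) (v := fun _ j => ((1 : ℝ) / 2) ^ j)
      (fun k _ => summable_geometric_of_lt_one (by norm_num) (by norm_num)) fun k _ => ?_
    rw [Nat.cofinite_eq_atTop]
    filter_upwards [Filter.eventually_ge_atTop (max k 1)] with j hj
    exact fun M => (hgbound k j M).trans (hdecay k j (le_trans (le_max_left _ _) hj) (le_trans (le_max_right _ _) hj))
  -- support of `Θ₁`
  have hΘ₁supp : tsupport Θ₁ ⊆ tsupport Θ := by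
    rw [hΘ₁]
    refine closure_minimal (fun M hM => ?_) (isClosed_tsupport Θ)
    by_contra hMt
    apply hM
    have hzero : ∀ j, g j M = 0 := fun j => by
      rw [hg]
      have : ((derivAlong X)^[2 * j] Θ) M = 0 := image_eq_zero_of_notMem_tsupport fun h' => hMt (tsupport_iterate_derivAlong_subset X Θ _ h')
      simp only [this, mul_zero]
    simp only [hzero, tsum_zero]
  have hΘ₁c : HasCompactSupport Θ₁ :=
    HasCompactSupport.intro hc.isCompact fun M hM => image_eq_zero_of_notMem_tsupport fun h' => hM (hΘ₁supp h')
  -- pointwise bounds on the slices and the summability needed by B1 (b)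
  have hK : ∀ (M : A) (m : ℕ) (s : ℝ), ‖iteratedDeriv m (fun t : ℝ => Θ (M * exp (t • X))) s‖ ≤ C 0 m := by
    intro M m s
    rw [iteratedDeriv_comp_mul_exp_smul hΘ m M X s]
    simpa only [norm_iteratedFDeriv_zero] using hC 0 m (M * exp (s • X))
  have hsum : Summable fun j => b j * C 0 (2 * j) := by
    refine Summable.of_norm_bounded_eventually_nat (g := fun j : ℕ => ((1 : ℝ) / 2) ^ j)
      (summable_geometric_of_lt_one (by norm_num) (by norm_num)) ?_
    filter_upwards [Filter.eventually_ge_atTop 1] with j hj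
    rw [Real.norm_eq_abs, abs_of_nonneg (mul_nonneg (hb0 j) (hC0 0 _))]
    exact hdecay 0 j (Nat.zero_le _) hj
  refine ⟨f, h, Θ₁, hf, hfc, hfs, hh, hhc, hhs, hΘ₁s, hΘ₁c, hΘ₁supp, hΘ₁supp.trans hU, fun M => ?_⟩
  -- B1 (b) on the slice through `M`, at `x = 0`
  have key := eq_integral_sub_integral_of_bounded_iteratedDeriv hf hfc hhc hlim hb0 (contDiff_comp_mul_exp_smul hΘ M X) (hK M) hsum 0
  rw [zero_smul, exp_zero, mul_one] at key
  rw [key]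
  congr 1
  · refine integral_congr_ae (Eventually.of_forall fun s => ?_)
    simp only [zero_sub, hΘ₁, hg, iteratedDeriv_comp_mul_exp_smul hΘ _ M X]
  · refine integral_congr_ae (Eventually.of_forall fun s => ?_)
    simp only [zero_sub]

/-- **One step, reflected form** (`s ↦ −s` in both integrals; `[−δ, δ]` is symmetric): `Θ(M) = Σ_{a ∈ Fin 2} ∫ φ_a(t) Ξ_a(M · e^{tX}) dt` with
`φ₀ = f(−·)`, `Ξ₀ = Θ₁`, `φ₁ = −h(−·)`, `Ξ₁ = Θ` — the shape iterated in §2. [cite: DixmierMalliavin1978, §3 Thm. 3.1] -/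
theorem exists_step_sum (Θ : A → ℂ) (hΘ : ContDiff ℝ ∞ Θ) (hc : HasCompactSupport Θ) (hU : tsupport Θ ⊆ {M | IsUnit M}) (X : A)
    {δ : ℝ} (hδ : 0 < δ) :
    ∃ (φ : Fin 2 → ℝ → ℂ) (Ξ : Fin 2 → A → ℂ),
      (∀ a, ContDiff ℝ ∞ (φ a) ∧ HasCompactSupport (φ a) ∧ tsupport (φ a) ⊆ Set.Icc (-δ) δ) ∧
      (∀ a, ContDiff ℝ ∞ (Ξ a) ∧ HasCompactSupport (Ξ a) ∧ tsupport (Ξ a) ⊆ {M | IsUnit M}) ∧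
      ∀ M, Θ M = ∑ a, ∫ t, φ a t * Ξ a (M * exp (t • X)) := by
  obtain ⟨f, h, Θ₁, hf, hfc, hfs, hh, hhc, hhs, hΘ₁s, hΘ₁c, -, hΘ₁U, hstep⟩ := exists_step Θ hΘ hc hU X hδ
  -- reflection `t ↦ −t` keeps smoothness, compact support and the symmetric support bound
  have hrefl : ∀ k : ℝ → ℂ, ContDiff ℝ ∞ k → HasCompactSupport k → tsupport k ⊆ Set.Icc (-δ) δ →
      ContDiff ℝ ∞ (fun t => k (-t)) ∧ HasCompactSupport (fun t => k (-t)) ∧ tsupport (fun t => k (-t)) ⊆ Set.Icc (-δ) δ := by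
    intro k hk hkc hks
    refine ⟨hk.comp contDiff_neg, hkc.comp_homeomorph (Homeomorph.neg ℝ), ?_⟩
    have : tsupport (fun t => k (-t)) = (fun t => -t) ⁻¹' tsupport k := by
      change tsupport (k ∘ (Homeomorph.neg ℝ)) = (Homeomorph.neg ℝ) ⁻¹' tsupport k
      exact tsupport_comp_eq_preimage k (Homeomorph.neg ℝ)
    rw [this]
    intro t ht
    have ht' := hks ht
    simp only [Set.mem_Icc] at ht' ⊢
    constructor <;> linarith [ht'.1, ht'.2]
  refine ⟨![fun t => f (-t), fun t => -h (-t)], ![Θ₁, Θ], ?_, ?_, fun M => ?_⟩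
  · intro a
    fin_cases a
    · exact hrefl f hf hfc hfs
    · obtain ⟨h1, h2, h3⟩ := hrefl h hh hhc hhs
      refine ⟨h1.neg, h2.neg, ?_⟩
      change tsupport (fun t => -h (-t)) ⊆ Set.Icc (-δ) δ
      have e : tsupport (fun t => -h (-t)) = tsupport (fun t => h (-t)) := by
        rw [tsupport, tsupport, Function.support_fun_neg]
      rw [e]
      exact h3
  · intro a
    fin_cases a
    · exact ⟨hΘ₁s, hΘ₁c, hΘ₁U⟩
    · exact ⟨hΘ, hc, hU⟩
  · rw [hstep M, Fin.sum_univ_two]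
    simp only [Matrix.cons_val_zero, Matrix.cons_val_one]
    rw [sub_eq_add_neg, ← integral_neg]
    congr 1
    · rw [← integral_neg_eq_self]
      refine integral_congr_ae (Eventually.of_forall fun t => ?_)
      simp only [neg_neg]
    · rw [← integral_neg_eq_self]
      refine integral_congr_ae (Eventually.of_forall fun t => ?_)
      simp only [neg_neg, neg_mul]

end Step

/-! ## §2 Iteration over finitely many directions -/

section Iterate

variable {A : Type*} [NormedRing A] [NormedAlgebra ℝ A] [CompleteSpace A]

omit [CompleteSpace A] in
/-- the flow product over `Fin (d+1)` splits off its first factor: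
`∏_{j ≤ d} e^{s_j X_j} = e^{s_0 X_0} · ∏_{j < d} e^{s_{j+1} X_{j+1}}` (`List.ofFn_succ`; the canonical coordinates of the second kind).
[cite: Knapp2002, Chap. I §10] -/
theorem prod_ofFn_exp_succ {d : ℕ} (X : Fin (d + 1) → A) (s : Fin (d + 1) → ℝ) :
    (List.ofFn fun j : Fin (d + 1) => exp (s j • X j)).prod =
      exp (s 0 • X 0) * (List.ofFn fun j : Fin d => exp (s j.succ • X j.succ)).prod := by
  rw [List.ofFn_succ, List.prod_cons]

/-- `s ↦ exp (s • Y)` is continuous (from ★ B3 `contDiff_mul_exp_smul`; one-parameter subgroups). [cite: Knapp2002, Chap. I §10] -/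
theorem continuous_exp_smul (Y : A) : Continuous fun s : ℝ => exp (s • Y) := by
  simpa only [one_mul] using (contDiff_mul_exp_smul (1 : A) Y).continuous

/-- the flow product `s ↦ ∏_j e^{s_j X_j}` (canonical coordinates of the second kind) is continuous. [cite: Knapp2002, Chap. I §10] -/
theorem continuous_prod_ofFn_exp {d : ℕ} (X : Fin d → A) :
    Continuous fun s : Fin d → ℝ => (List.ofFn fun j : Fin d => exp (s j • X j)).prod := by
  have h : ∀ s : Fin d → ℝ, (List.ofFn fun j : Fin d => exp (s j • X j)).prod =
      ((List.finRange d).map fun j => exp (s j • X j)).prod := fun s => by rw [List.ofFn_eq_map]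
  simp_rw [h]
  exact continuous_list_prod _ fun j _ => (continuous_exp_smul (X j)).comp (continuous_apply j)

/-- a product kernel `s ↦ ∏_j κ_j (s_j)` of compactly supported factors has compact support on `Fin d → ℝ` (the tensor kernels of the iterated
Dixmier–Malliavin step). [cite: DixmierMalliavin1978, §3 Thm. 3.1] -/
theorem hasCompactSupport_pi_prod {d : ℕ} {κ : Fin d → ℝ → ℂ} (hκ : ∀ j, HasCompactSupport (κ j)) :
    HasCompactSupport fun s : Fin d → ℝ => ∏ j, κ j (s j) := by
  refine HasCompactSupport.intro (isCompact_univ_pi fun j => (hκ j).isCompact) fun s hs => ?_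
  simp only [Set.mem_univ_pi, not_forall] at hs
  obtain ⟨j, hj⟩ := hs
  exact Finset.prod_eq_zero (Finset.mem_univ j) (image_eq_zero_of_notMem_tsupport hj)

/-- **ITERATION OF THE ONE-PARAMETER STEPS OVER `d` DIRECTIONS** [DixmierMalliavin1978, §3 Thm. 3.1, «en itérant»]: for `X : Fin d → A`, `Θ` smooth with compact
support inside the units and `δ > 0`, there are finitely many product kernels `∏_j κ_{i,j}(s_j)` (`κ_{i,j} ∈ C_c^∞(ℝ)`, `tsupport ⊆ [−δ, δ]`) and functions `Θ_i` of the
same class with **`Θ(M) = Σ_i ∫_{ℝ^d} (∏_j κ_{i,j}(s_j)) Θ_i(M · e^{s_0X_0} ⋯ e^{s_{d−1}X_{d−1}}) ds`** for every `M` (one step along `X_0`, §1, then the statement for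
`X ∘ Fin.succ` on each of the two new functions, and Fubini `ℝ × ℝ^d ≃ ℝ^{d+1}` — Mathlib `volume_preserving_piFinSuccAbove`, `integral_prod`).
[cite: DixmierMalliavin1978, §3 Thm. 3.1] -/
theorem exists_sum_integral_pi {d : ℕ} (X : Fin d → A) (Θ : A → ℂ) (hΘ : ContDiff ℝ ∞ Θ) (hc : HasCompactSupport Θ)
    (hU : tsupport Θ ⊆ {M | IsUnit M}) {δ : ℝ} (hδ : 0 < δ) :
    ∃ (ι : Type) (_ : Fintype ι) (κ : ι → Fin d → ℝ → ℂ) (Ξ : ι → A → ℂ),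
      (∀ i j, ContDiff ℝ ∞ (κ i j) ∧ HasCompactSupport (κ i j) ∧ tsupport (κ i j) ⊆ Set.Icc (-δ) δ) ∧
      (∀ i, ContDiff ℝ ∞ (Ξ i) ∧ HasCompactSupport (Ξ i) ∧ tsupport (Ξ i) ⊆ {M | IsUnit M}) ∧
      ∀ M, Θ M = ∑ i, ∫ s : Fin d → ℝ, (∏ j, κ i j (s j)) * Ξ i (M * (List.ofFn fun j : Fin d => exp (s j • X j)).prod) := by
  induction d generalizing Θ with
  | zero =>
    refine ⟨Unit, inferInstance, fun _ => Fin.elim0, fun _ => Θ, fun _ j => j.elim0, fun _ => ⟨hΘ, hc, hU⟩, fun M => ?_⟩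
    rw [Fintype.sum_unique]
    simp only [Finset.univ_eq_empty, Finset.prod_empty, List.ofFn_zero, List.prod_nil, mul_one, one_mul, integral_const]
    first
    | rw [one_smul]
    | rw [show (volume : Measure (Fin 0 → ℝ)).real Set.univ = 1 from by
          rw [Measure.real, volume_pi, Measure.pi_univ, Finset.univ_eq_empty, Finset.prod_empty, ENNReal.toReal_one], one_smul]
  | succ d ih =>
    -- one step along `X 0`, reflected form
    obtain ⟨φ, Ξ₀, hφ, hΞ₀, hstep⟩ := exists_step_sum Θ hΘ hc hU (X 0) hδ
    -- the statement for the remaining directions on each `Ξ₀ a`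
    have hrec := fun a : Fin 2 => ih (fun j => X j.succ) (Ξ₀ a) (hΞ₀ a).1 (hΞ₀ a).2.1 (hΞ₀ a).2.2
    choose ι hι κ Ξ hκ hΞ hsum using hrec
    letI : ∀ a, Fintype (ι a) := hι
    refine ⟨Σ a : Fin 2, ι a, inferInstance, fun i => Fin.cons (φ i.1) (κ i.1 i.2), fun i => Ξ i.1 i.2, ?_, fun i => hΞ i.1 i.2,
      fun M => ?_⟩
    · rintro ⟨a, i⟩ j
      refine Fin.cases ?_ (fun j => ?_) j
      · simpa only [Fin.cons_zero] using hφ a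
      · simpa only [Fin.cons_succ] using hκ a i j
    -- the main identity
    rw [hstep M, Fintype.sum_sigma]
    refine Finset.sum_congr rfl fun a _ => ?_
    -- rewrite `Ξ₀ a` under the integral and distribute
    have h1 : (fun t : ℝ => φ a t * Ξ₀ a (M * exp (t • X 0))) = fun t => ∑ i, φ a t *
        ∫ s : Fin d → ℝ, (∏ j, κ a i j (s j)) * Ξ a i (M * exp (t • X 0) * (List.ofFn fun j : Fin d => exp (s j • X j.succ)).prod) := by
      funext t
      rw [hsum a (M * exp (t • X 0)), Finset.mul_sum]
    -- the joint integrands and their integrability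
    have hF : ∀ i : ι a, Integrable (fun p : ℝ × (Fin d → ℝ) => φ a p.1 * ((∏ j, κ a i j (p.2 j)) *
        Ξ a i (M * exp (p.1 • X 0) * (List.ofFn fun j : Fin d => exp (p.2 j • X j.succ)).prod))) := by
      intro i
      have hcont : Continuous fun p : ℝ × (Fin d → ℝ) => φ a p.1 * ((∏ j, κ a i j (p.2 j)) *
          Ξ a i (M * exp (p.1 • X 0) * (List.ofFn fun j : Fin d => exp (p.2 j • X j.succ)).prod)) := by
        refine ((hφ a).1.continuous.comp continuous_fst).mul ((?_ : Continuous _).mul ?_)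
        · exact continuous_finsetProd _ fun j _ => (hκ a i j).1.continuous.comp ((continuous_apply j).comp continuous_snd)
        · refine (hΞ a i).1.continuous.comp ?_
          exact ((continuous_const.mul ((continuous_exp_smul (X 0)).comp continuous_fst)).mul
            ((continuous_prod_ofFn_exp fun j => X j.succ).comp continuous_snd))
      have hsupp : HasCompactSupport fun p : ℝ × (Fin d → ℝ) => φ a p.1 * ((∏ j, κ a i j (p.2 j)) *
          Ξ a i (M * exp (p.1 • X 0) * (List.ofFn fun j : Fin d => exp (p.2 j • X j.succ)).prod)) := by
        refine HasCompactSupport.intro ((hφ a).2.1.isCompact.prod (hasCompactSupport_pi_prod fun j => (hκ a i j).2.1).isCompact)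
          fun p hp => ?_
        rw [Set.mem_prod, not_and_or] at hp
        rcases hp with hp | hp
        · rw [image_eq_zero_of_notMem_tsupport hp, zero_mul]
        · rw [image_eq_zero_of_notMem_tsupport hp, zero_mul, mul_zero]
      exact hcont.integrable_of_hasCompactSupport hsupp
    -- the `t`-integrands are integrable (Fubini) and the sum commutes with the `t`-integral
    have hFt : ∀ i : ι a, Integrable (fun t : ℝ => φ a t *
        ∫ s : Fin d → ℝ, (∏ j, κ a i j (s j)) * Ξ a i (M * exp (t • X 0) * (List.ofFn fun j : Fin d => exp (s j • X j.succ)).prod)) := by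
      intro i
      have h := (hF i).integral_prod_left
      refine h.congr (Eventually.of_forall fun t => ?_)
      dsimp only
      exact integral_const_mul _ _
    rw [h1, integral_finsetSum _ fun i _ => hFt i]
    refine Finset.sum_congr rfl fun i _ => ?_
    -- Fubini: `ℝ × ℝ^d ≃ ℝ^{d+1}`
    rw [← ((volume_preserving_piFinSuccAbove (fun _ : Fin (d + 1) => ℝ) 0).symm).integral_comp']
    have h2 : ∀ p : ℝ × (Fin d → ℝ),
        (∏ j, (Fin.cons (φ a) (κ a i) : Fin (d + 1) → ℝ → ℂ) j ((MeasurableEquiv.piFinSuccAbove (fun _ : Fin (d + 1) => ℝ) 0).symm p j)) *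
          Ξ a i (M * (List.ofFn fun j : Fin (d + 1) => exp ((MeasurableEquiv.piFinSuccAbove (fun _ : Fin (d + 1) => ℝ) 0).symm p j • X j)).prod) =
        φ a p.1 * ((∏ j, κ a i j (p.2 j)) * Ξ a i (M * exp (p.1 • X 0) * (List.ofFn fun j : Fin d => exp (p.2 j • X j.succ)).prod)) := by
      intro p
      have hp : ∀ j, (MeasurableEquiv.piFinSuccAbove (fun _ : Fin (d + 1) => ℝ) 0).symm p j = (Fin.cons p.1 p.2 : Fin (d + 1) → ℝ) j :=
        fun j => by
          rw [MeasurableEquiv.piFinSuccAbove_symm_apply, Fin.insertNthEquiv_zero]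
          rfl
      simp only [hp, Fin.prod_univ_succ, Fin.cons_zero, Fin.cons_succ, prod_ofFn_exp_succ, mul_assoc]
    simp_rw [h2]
    rw [Measure.volume_eq_prod, integral_prod _ ((Measure.volume_eq_prod ℝ (Fin d → ℝ)) ▸ hF i)]
    refine integral_congr_ae (Eventually.of_forall fun t => ?_)
    dsimp only
    exact (integral_const_mul _ _).symm

end Iterate

end Literature.Analysis.Convolution.DixmierMalliavin

end
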